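import Mathlib.LinearAlgebra.Matrix.Adjugate
import Mathlib.LinearAlgebra.Matrix.Trace
import Mathlib.LinearAlgebra.Matrix.Notation
import Mathlib.Data.ZMod.Basic
import Mathlib.Tactic.NoncommRing
import Mathlib.Tactic.LinearCombination
import Mathlib.Tactic.FinCases
import HarnessLib

/-!
# `GL₂(ℤ/8ℤ)`: the three quadratic characters `χ₂ ∘ det`, `χ₋₁ ∘ det`, `sgn ∘ (mod 2)` (bookkeeping, proofs only)

`Proofs`-style helper layer (concrete bookkeeping definitions and theorems only: no named fact, no
instance; D-0014/D-0026) for `GL2ModEightFullImageProofs` — the group-theoretic computation behind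
T. Dokchitser, V. Dokchitser, *Surjectivity of mod `2ⁿ` representations of elliptic curves*, Math.
Z. 272 (2012) 961–964, Theorem, clause (3) ("a computation shows that the only such subgroup of
`GL₂(ℤ/8ℤ)` is the full group itself", proof of (3)) and the remark in the same proof that
`(mod 2, det) : GL₂(ℤ/8ℤ) → S₃ × (ℤ/8ℤ)^×` is onto.  Matrices are `Matrix (Fin 2) (Fin 2) (ZMod 8)`
with "invertible" spelled `g.det * g.det = 1` (the units of `ℤ/8` are `1, 3, 5, 7`, all of square `1`).

* §1 scalar facts in `ℤ/8` (kernel `decide`); the additive quadratic characters of `(ℤ/8)^×`: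
  `c2 d = 1 ↔ d ≡ ±3` (the character cutting out `√2`: `σ√2 = -√2` iff `χ_cyc(σ) ≡ ±3 (mod 8)`),
  `cm1 d = 1 ↔ d ≡ 3 (mod 4)` (cutting out `√-1`); `c2 + cm1` cuts out `√-2`.
* §2 the parity vector `par g ∈ (ℤ/2)⁴` of a matrix (its reduction modulo `2`, as a `4`-tuple so that
  statements about `GL₂(𝔽₂)` are cheap kernel computations), the sign character `sg g ∈ ℤ/2` of
  `g mod 2 ∈ GL₂(𝔽₂) ≅ S₃` (`0` on the identity and the two `3`-cycles, `1` on the three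
  transpositions), multiplicative on invertible matrices (`sg_mul`), and the **sign datum**
  `phi g = (c2 (det g), cm1 (det g), sg g) ∈ (ℤ/2)³` — the homomorphism `GL₂(ℤ/8) → C₂³` whose
  kernel is the index-`8` subgroup `{det = 1, even modulo 2}` (`phi_mul`).
* §3 the inverse `inv' g = det g • adj g` of an invertible matrix, `(1 + 4A)² = 1`, the sign datum of
  a matrix `≡ 1 (mod 4)` (`phi (1 + 4A) ∈ {0, (1,0,0)}`), explicit representatives `rep v` of the
  eight classes (`phi (rep v) = v`), and `sgnUnit : ℤ/2 → {±1} ⊂ ℤ` for the curve-side bookkeeping.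

## References

* [DokchitserDokchitserMathZ2012] T. Dokchitser, V. Dokchitser, Math. Z. 272 (2012) 961–964,
  proof of the Theorem, clause (3). [corpus:paper:arxiv-1104.5031 p0001 L58–L98]
* [SerreAbelianLAdic1968] J.-P. Serre, *Abelian `ℓ`-adic representations and elliptic curves*,
  Benjamin (1968), IV.3.4 (subgroups of `GL₂` over `ℤ/ℓⁿ`).
-/

set_option autoImplicit false

namespace Literature.NumberTheory.GaloisRepresentations.GL2Mod8

open Matrix

/-- `2 × 2` matrices over `ℤ/8ℤ` (bookkeeping abbreviation). [folklore] -/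
abbrev M8 := Matrix (Fin 2) (Fin 2) (ZMod 8)

/-! ### §1. Scalars: `ℤ/8ℤ`, its units `{1,3,5,7}`, reduction modulo `2`, the characters -/

/-- Reduction modulo `2`, `ℤ/8ℤ → ℤ/2ℤ`. [folklore] -/
def red : ZMod 8 →+* ZMod 2 := ZMod.castHom (by norm_num : 2 ∣ 8) (ZMod 2)

/-- The units of `ℤ/8` are the odd residues, and each has square `1`.
[cite: DokchitserDokchitserMathZ2012, proof of Theorem (3) (bookkeeping for the computation in GL₂(ℤ/8ℤ))] -/
theorem mul_self_eq_one_iff (d : ZMod 8) : d * d = 1 ↔ red d = 1 := by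
  revert d; decide

/-- An odd residue is `1, 3, 5` or `7`.
[cite: DokchitserDokchitserMathZ2012, proof of Theorem (3) (bookkeeping for the computation in GL₂(ℤ/8ℤ))] -/
theorem eq_of_red_eq_one (d : ZMod 8) (h : red d = 1) : d = 1 ∨ d = 3 ∨ d = 5 ∨ d = 7 := by
  revert d; decide

/-- If `d d' = 1` then `d' = d` (every unit of `ℤ/8` is an involution).
[cite: DokchitserDokchitserMathZ2012, proof of Theorem (3) (bookkeeping for the computation in GL₂(ℤ/8ℤ))] -/
theorem eq_of_mul_eq_one {d d' : ZMod 8} (h : d * d' = 1) : d' = d := by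
  revert d d'; decide

/-- If `d d' = 1` then `d² = 1`.
[cite: DokchitserDokchitserMathZ2012, proof of Theorem (3) (bookkeeping for the computation in GL₂(ℤ/8ℤ))] -/
theorem mul_self_of_mul_eq_one {d d' : ZMod 8} (h : d * d' = 1) : d * d = 1 := by
  revert d d'; decide

/-- An even residue is `2y`.
[cite: DokchitserDokchitserMathZ2012, proof of Theorem (3) (bookkeeping for the computation in GL₂(ℤ/8ℤ))] -/
theorem exists_eq_two_mul {x : ZMod 8} (h : red x = 0) : ∃ y : ZMod 8, x = 2 * y := by
  revert x; decide

/-- A residue killed by `4` is `2y`.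
[cite: DokchitserDokchitserMathZ2012, proof of Theorem (3) (bookkeeping for the computation in GL₂(ℤ/8ℤ))] -/
theorem exists_eq_two_mul_of_four_mul {x : ZMod 8} (h : 4 * x = 0) : ∃ y : ZMod 8, x = 2 * y := by
  revert x; decide

/-- `2x = 2y` in `ℤ/8` iff `x ≡ y (mod 4)`: `x = y + 4t`.
[cite: DokchitserDokchitserMathZ2012, proof of Theorem (3) (bookkeeping for the computation in GL₂(ℤ/8ℤ))] -/
theorem exists_eq_add_four_mul {x y : ZMod 8} (h : 2 * x = 2 * y) : ∃ t : ZMod 8, x = y + 4 * t := by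
  revert x y; decide

/-- `4x ∈ {0, 4}`.
[cite: DokchitserDokchitserMathZ2012, proof of Theorem (3) (bookkeeping for the computation in GL₂(ℤ/8ℤ))] -/
theorem four_mul_eq_zero_or (x : ZMod 8) : 4 * x = 0 ∨ 4 * x = 4 := by
  revert x; decide

/-- `4x = 0` for even `x`.
[cite: DokchitserDokchitserMathZ2012, proof of Theorem (3) (bookkeeping for the computation in GL₂(ℤ/8ℤ))] -/
theorem four_mul_eq_zero_of_red {x : ZMod 8} (h : red x = 0) : 4 * x = 0 := by
  revert x; decide

/-- `4x = 4` for odd `x`.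
[cite: DokchitserDokchitserMathZ2012, proof of Theorem (3) (bookkeeping for the computation in GL₂(ℤ/8ℤ))] -/
theorem four_mul_eq_four_of_red {x : ZMod 8} (h : red x = 1) : 4 * x = 4 := by
  revert x; decide

/-- `x + y = 2t ⟹ 4x = 4y`.
[cite: DokchitserDokchitserMathZ2012, proof of Theorem (3) (bookkeeping for the computation in GL₂(ℤ/8ℤ))] -/
theorem four_mul_eq_of_add_eq_two_mul {x y t : ZMod 8} (h : x + y = 2 * t) : 4 * x = 4 * y := by
  revert x y t; decide

/-- `red (1 + 4x) = 1`, `red (4x) = 0`, `red (2x) = 0`.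
[cite: DokchitserDokchitserMathZ2012, proof of Theorem (3) (bookkeeping for the computation in GL₂(ℤ/8ℤ))] -/
theorem red_one_add_four_mul (x : ZMod 8) : red (1 + 4 * x) = 1 := by revert x; decide

/-- `red (4x) = 0`.
[cite: DokchitserDokchitserMathZ2012, proof of Theorem (3) (bookkeeping for the computation in GL₂(ℤ/8ℤ))] -/
theorem red_four_mul (x : ZMod 8) : red (4 * x) = 0 := by revert x; decide

/-- `red (2x) = 0`.
[cite: DokchitserDokchitserMathZ2012, proof of Theorem (3) (bookkeeping for the computation in GL₂(ℤ/8ℤ))] -/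
theorem red_two_mul (x : ZMod 8) : red (2 * x) = 0 := by revert x; decide

/-- The additive character of `(ℤ/8)^×` cutting out `√2`: `c2 d = 1` iff `d ≡ ±3 (mod 8)`
(for a primitive eighth root of unity `ζ`, `ζ^d + ζ^{-d} = -(ζ + ζ⁻¹)` exactly for these `d`).
[folklore] -/
def c2 (d : ZMod 8) : ZMod 2 := if d = 3 ∨ d = 5 then 1 else 0

/-- The additive character of `(ℤ/8)^×` cutting out `√-1`: `cm1 d = 1` iff `d ≡ 3 (mod 4)`.
[folklore] -/
def cm1 (d : ZMod 8) : ZMod 2 := if d = 3 ∨ d = 7 then 1 else 0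

/-- `c2` is additive on units.
[cite: DokchitserDokchitserMathZ2012, proof of Theorem (3) (bookkeeping for the computation in GL₂(ℤ/8ℤ))] -/
theorem c2_mul {d d' : ZMod 8} (hd : d * d = 1) (hd' : d' * d' = 1) : c2 (d * d') = c2 d + c2 d' := by
  revert d d'; decide

/-- `cm1` is additive on units.
[cite: DokchitserDokchitserMathZ2012, proof of Theorem (3) (bookkeeping for the computation in GL₂(ℤ/8ℤ))] -/
theorem cm1_mul {d d' : ZMod 8} (hd : d * d = 1) (hd' : d' * d' = 1) :
    cm1 (d * d') = cm1 d + cm1 d' := by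
  revert d d'; decide

/-- A unit with trivial `c2` and `cm1` is `1`.
[cite: DokchitserDokchitserMathZ2012, proof of Theorem (3) (bookkeeping for the computation in GL₂(ℤ/8ℤ))] -/
theorem eq_one_of_c2_of_cm1 {d : ZMod 8} (hd : d * d = 1) (h2 : c2 d = 0) (hm1 : cm1 d = 0) : d = 1 := by
  revert d; decide

/-- `cm1 (1 + 4x) = 0`.
[cite: DokchitserDokchitserMathZ2012, proof of Theorem (3) (bookkeeping for the computation in GL₂(ℤ/8ℤ))] -/
theorem cm1_one_add_four_mul (x : ZMod 8) : cm1 (1 + 4 * x) = 0 := by revert x; decide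

/-! ### §2. Parity vectors, the sign character of `GL₂(𝔽₂) ≅ S₃`, the sign datum -/

/-- `(ℤ/2)⁴`, holding the reduction modulo `2` of a `2 × 2` matrix as `(ā, b̄, c̄, d̄)`
(bookkeeping abbreviation). [folklore] -/
abbrev P4 := ZMod 2 × ZMod 2 × ZMod 2 × ZMod 2

/-- Product of two parity vectors (matrix multiplication over `𝔽₂`). [folklore] -/
def P4.mul (p q : P4) : P4 :=
  (p.1 * q.1 + p.2.1 * q.2.2.1, p.1 * q.2.1 + p.2.1 * q.2.2.2,
    p.2.2.1 * q.1 + p.2.2.2 * q.2.2.1, p.2.2.1 * q.2.1 + p.2.2.2 * q.2.2.2)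

/-- Determinant of a parity vector (over `𝔽₂`). [folklore] -/
def P4.det (p : P4) : ZMod 2 := p.1 * p.2.2.2 - p.2.1 * p.2.2.1

/-- The parity vector (reduction modulo `2`) of a matrix over `ℤ/8`. [folklore] -/
def par (g : M8) : P4 := (red (g 0 0), red (g 0 1), red (g 1 0), red (g 1 1))

/-- Reduction modulo `2` is multiplicative.
[cite: DokchitserDokchitserMathZ2012, proof of Theorem (3) (bookkeeping for the computation in GL₂(ℤ/8ℤ))] -/
theorem par_mul (g h : M8) : par (g * h) = P4.mul (par g) (par h) := by
  simp [par, P4.mul, Matrix.mul_apply, Fin.sum_univ_two, map_add, map_mul]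

/-- Reduction modulo `2` commutes with the determinant.
[cite: DokchitserDokchitserMathZ2012, proof of Theorem (3) (bookkeeping for the computation in GL₂(ℤ/8ℤ))] -/
theorem red_det (g : M8) : red g.det = P4.det (par g) := by
  simp [Matrix.det_fin_two, par, P4.det, map_sub, map_mul]

/-- The parity vector of `1`.
[cite: DokchitserDokchitserMathZ2012, proof of Theorem (3) (bookkeeping for the computation in GL₂(ℤ/8ℤ))] -/
theorem par_one : par (1 : M8) = (1, 0, 0, 1) := by decide

/-- The sign character of `GL₂(𝔽₂) ≅ S₃` on parity vectors: `0` at the identity and at the two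
elements of order `3` (trace `1`), `1` at the three involutions. [folklore] -/
def eps (p : P4) : ZMod 2 := if (p.2.1 = 0 ∧ p.2.2.1 = 0) ∨ p.1 + p.2.2.2 = 1 then 0 else 1

/-- `eps` is a homomorphism on `GL₂(𝔽₂)` (kernel check of the `36` products).
[cite: DokchitserDokchitserMathZ2012, proof of Theorem (3) (bookkeeping for the computation in GL₂(ℤ/8ℤ))] -/
theorem eps_mul : ∀ p q : P4, P4.det p = 1 → P4.det q = 1 → eps (P4.mul p q) = eps p + eps q := by
  decide

/-- The parity vectors of determinant `1` and sign `0` are `1`, `w̄ = (0,1,1,1)`, `w̄² = (1,1,1,0)`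
(the subgroup `A₃ ⊂ S₃`).
[cite: DokchitserDokchitserMathZ2012, proof of Theorem (3) (bookkeeping for the computation in GL₂(ℤ/8ℤ))] -/
theorem eps_eq_zero_cases : ∀ p : P4, P4.det p = 1 → eps p = 0 →
    p = (1, 0, 0, 1) ∨ p = (0, 1, 1, 1) ∨ p = (1, 1, 1, 0) := by
  decide

/-- The sign `sg g ∈ ℤ/2` of (the reduction modulo `2` of) a matrix `g`. [folklore] -/
def sg (g : M8) : ZMod 2 := eps (par g)

/-- `sg` is additive on invertible matrices.
[cite: DokchitserDokchitserMathZ2012, proof of Theorem (3) (bookkeeping for the computation in GL₂(ℤ/8ℤ))] -/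
theorem sg_mul {g h : M8} (hg : g.det * g.det = 1) (hh : h.det * h.det = 1) :
    sg (g * h) = sg g + sg h := by
  unfold sg
  rw [par_mul]
  exact eps_mul _ _ (by rw [← red_det]; exact (mul_self_eq_one_iff _).mp hg)
    (by rw [← red_det]; exact (mul_self_eq_one_iff _).mp hh)

/-- The abelian group `(ℤ/2)³` of sign data (bookkeeping abbreviation). [folklore] -/
abbrev V3 := ZMod 2 × ZMod 2 × ZMod 2

/-- **The sign datum** `phi g = (c2 (det g), cm1 (det g), sg g)`: the values at `g` of the three
quadratic characters `χ₂ ∘ det`, `χ₋₁ ∘ det`, `sgn ∘ (mod 2)` of `GL₂(ℤ/8ℤ)` (its map onto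
`S₃^{ab} × (ℤ/8ℤ)^× ≅ C₂³`). [cite: DokchitserDokchitserMathZ2012, proof of the Theorem ((mod 2, det) onto S₃ × (ℤ/8ℤ)^×)] -/
def phi (g : M8) : V3 := (c2 g.det, cm1 g.det, sg g)

/-- `phi` is a homomorphism on invertible matrices.
[cite: DokchitserDokchitserMathZ2012, proof of Theorem (3) (bookkeeping for the computation in GL₂(ℤ/8ℤ))] -/
theorem phi_mul {g h : M8} (hg : g.det * g.det = 1) (hh : h.det * h.det = 1) :
    phi (g * h) = phi g + phi h := by
  simp only [phi, Matrix.det_mul, Prod.mk_add_mk, c2_mul hg hh, cm1_mul hg hh, sg_mul hg hh]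

/-- `phi 1 = 0`.
[cite: DokchitserDokchitserMathZ2012, proof of Theorem (3) (bookkeeping for the computation in GL₂(ℤ/8ℤ))] -/
theorem phi_one : phi (1 : M8) = 0 := by decide

/-- In `(ℤ/2)³`: `x + y = 0 ⟹ y = x`; `x + x = 0`.
[cite: DokchitserDokchitserMathZ2012, proof of Theorem (3) (bookkeeping for the computation in GL₂(ℤ/8ℤ))] -/
theorem V3.eq_of_add_eq_zero : ∀ x y : V3, x + y = 0 → y = x := by decide

/-- `x + x = 0` in `(ℤ/2)³`.
[cite: DokchitserDokchitserMathZ2012, proof of Theorem (3) (bookkeeping for the computation in GL₂(ℤ/8ℤ))] -/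
theorem V3.add_self : ∀ x : V3, x + x = 0 := by decide

/-! ### §3. Inverses, matrices `≡ 1 (mod 4)`, class representatives, signs -/

/-- The inverse of a matrix with `det² = 1`: `det • adj`. [folklore] -/
def inv' (s : M8) : M8 := s.det • s.adjugate

/-- `s · inv' s = 1`.
[cite: DokchitserDokchitserMathZ2012, proof of Theorem (3) (bookkeeping for the computation in GL₂(ℤ/8ℤ))] -/
theorem mul_inv' {s : M8} (hs : s.det * s.det = 1) : s * inv' s = 1 := by
  rw [inv', Matrix.mul_smul, Matrix.mul_adjugate, smul_smul, hs, one_smul]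

/-- `inv' s · s = 1`.
[cite: DokchitserDokchitserMathZ2012, proof of Theorem (3) (bookkeeping for the computation in GL₂(ℤ/8ℤ))] -/
theorem inv'_mul {s : M8} (hs : s.det * s.det = 1) : inv' s * s = 1 := by
  rw [inv', Matrix.smul_mul, Matrix.adjugate_mul, smul_smul, hs, one_smul]

/-- `det (inv' s)` is again a unit.
[cite: DokchitserDokchitserMathZ2012, proof of Theorem (3) (bookkeeping for the computation in GL₂(ℤ/8ℤ))] -/
theorem det_inv'_mul_self {s : M8} (hs : s.det * s.det = 1) : (inv' s).det * (inv' s).det = 1 := by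
  have h : (inv' s).det * s.det = 1 := by rw [← Matrix.det_mul, inv'_mul hs, Matrix.det_one]
  exact mul_self_of_mul_eq_one h

/-- `phi (inv' s) = phi s` (the target has exponent `2`).
[cite: DokchitserDokchitserMathZ2012, proof of Theorem (3) (bookkeeping for the computation in GL₂(ℤ/8ℤ))] -/
theorem phi_inv' {s : M8} (hs : s.det * s.det = 1) : phi (inv' s) = phi s := by
  apply V3.eq_of_add_eq_zero
  rw [← phi_mul hs (det_inv'_mul_self hs), mul_inv' hs, phi_one]

/-- `8 = 0` in `M₂(ℤ/8)`.
[cite: DokchitserDokchitserMathZ2012, proof of Theorem (3) (bookkeeping for the computation in GL₂(ℤ/8ℤ))] -/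
theorem eight_eq_zero : (8 : M8) = 0 := by
  ext i j
  fin_cases i <;> fin_cases j <;> simp <;> decide

/-- `(1 + 4A)² = 1`.
[cite: DokchitserDokchitserMathZ2012, proof of Theorem (3) (bookkeeping for the computation in GL₂(ℤ/8ℤ))] -/
theorem one_add_four_mul_sq (A : M8) : (1 + 4 * A) * (1 + 4 * A) = 1 := by
  have h : (1 + 4 * A) * (1 + 4 * A) = 1 + 8 * (A + 2 * (A * A)) := by noncomm_ring
  rw [h, eight_eq_zero, zero_mul, add_zero]

/-- `det (1 + 4A)` is a unit.
[cite: DokchitserDokchitserMathZ2012, proof of Theorem (3) (bookkeeping for the computation in GL₂(ℤ/8ℤ))] -/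
theorem det_one_add_four_mul (A : M8) : (1 + 4 * A).det * (1 + 4 * A).det = 1 := by
  rw [← Matrix.det_mul, one_add_four_mul_sq, Matrix.det_one]

/-- `det (1 + 4A) = 1 + 4 tr A`.
[cite: DokchitserDokchitserMathZ2012, proof of Theorem (3) (bookkeeping for the computation in GL₂(ℤ/8ℤ))] -/
theorem det_one_add_four_mul_eq (A : M8) : (1 + 4 * A).det = 1 + 4 * (A 0 0 + A 1 1) := by
  have h8 : (8 : ZMod 8) = 0 := by decide
  rw [Matrix.det_fin_two]
  simp [Matrix.mul_apply, Matrix.ofNat_apply]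
  linear_combination (2 * A 0 0 * A 1 1 - 2 * A 0 1 * A 1 0) * h8

/-- The sign datum of a matrix `≡ 1 (mod 4)` is `0` or `(1, 0, 0)` (`det (1 + 4A) = 1 + 4 tr A ∈ {1, 5}`,
and `1 + 4A ≡ 1 (mod 2)`).
[cite: DokchitserDokchitserMathZ2012, proof of Theorem (3) (bookkeeping for the computation in GL₂(ℤ/8ℤ))] -/
theorem phi_one_add_four_mul (A : M8) : phi (1 + 4 * A) = 0 ∨ phi (1 + 4 * A) = (1, 0, 0) := by
  have hsg : sg (1 + 4 * A) = 0 := by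
    have hp : par (1 + 4 * A) = (1, 0, 0, 1) := by
      simp [par, Matrix.mul_apply, Matrix.ofNat_apply, red_one_add_four_mul, red_four_mul]
    simp [sg, hp, eps]
  have hm1 : cm1 (1 + 4 * A).det = 0 := by rw [det_one_add_four_mul_eq]; exact cm1_one_add_four_mul _
  rcases (by decide : ∀ z : ZMod 2, z = 0 ∨ z = 1) (c2 (1 + 4 * A).det) with h | h
  · left; simp only [phi, h, hm1, hsg]; rfl
  · right; simp only [phi, h, hm1, hsg]

/-- `g + 4T = g · (1 + 4 · inv'(g) T)` for invertible `g`.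
[cite: DokchitserDokchitserMathZ2012, proof of Theorem (3) (bookkeeping for the computation in GL₂(ℤ/8ℤ))] -/
theorem add_four_mul_eq {g : M8} (hg : g.det * g.det = 1) (T : M8) :
    g + 4 * T = g * (1 + 4 * (inv' g * T)) := by
  rw [mul_add, mul_one, show g * (4 * (inv' g * T)) = 4 * ((g * inv' g) * T) by noncomm_ring,
    mul_inv' hg, one_mul]

/-- Representatives of the eight sign data: `rep v = (1 e; 0 d)` with `e ∈ {0,1}` the third
coordinate and `d ∈ {1,5,7,3}` realising the first two. [folklore] -/
def rep (v : V3) : M8 :=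
  !![1, if v.2.2 = 0 then 0 else 1;
     0, if v.1 = 0 then (if v.2.1 = 0 then 1 else 7) else (if v.2.1 = 0 then 5 else 3)]

/-- `phi (rep v) = v`.
[cite: DokchitserDokchitserMathZ2012, proof of Theorem (3) (bookkeeping for the computation in GL₂(ℤ/8ℤ))] -/
theorem phi_rep : ∀ v : V3, phi (rep v) = v := by decide

/-- `rep v` is invertible.
[cite: DokchitserDokchitserMathZ2012, proof of Theorem (3) (bookkeeping for the computation in GL₂(ℤ/8ℤ))] -/
theorem det_rep : ∀ v : V3, (rep v).det * (rep v).det = 1 := by decide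

/-- The sign `±1 ∈ ℤ` attached to an element of `ℤ/2` (bookkeeping for the Galois action on
`√2`, `√-2`, `√Δ`). [folklore] -/
def sgnUnit (x : ZMod 2) : ℤ := if x = 0 then 1 else -1

/-- `sgnUnit 0 = 1`.
[cite: DokchitserDokchitserMathZ2012, proof of Theorem (3) (bookkeeping for the computation in GL₂(ℤ/8ℤ))] -/
@[simp] theorem sgnUnit_zero : sgnUnit 0 = 1 := rfl

/-- `sgnUnit 1 = -1`.
[cite: DokchitserDokchitserMathZ2012, proof of Theorem (3) (bookkeeping for the computation in GL₂(ℤ/8ℤ))] -/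
@[simp] theorem sgnUnit_one : sgnUnit 1 = -1 := rfl

/-- `sgnUnit` is multiplicative.
[cite: DokchitserDokchitserMathZ2012, proof of Theorem (3) (bookkeeping for the computation in GL₂(ℤ/8ℤ))] -/
theorem sgnUnit_add : ∀ x y : ZMod 2, sgnUnit (x + y) = sgnUnit x * sgnUnit y := by decide

/-- `sgnUnit x = -1 ↔ x = 1`, and `sgnUnit x ≠ 1 → x = 1`.
[cite: DokchitserDokchitserMathZ2012, proof of Theorem (3) (bookkeeping for the computation in GL₂(ℤ/8ℤ))] -/
theorem eq_one_of_sgnUnit_ne_one : ∀ x : ZMod 2, sgnUnit x ≠ 1 → x = 1 := by decide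

end Literature.NumberTheory.GaloisRepresentations.GL2Mod8
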